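import Summits.QuantumFields.YangMills.Theses.RenyiTelescope

/-!
# Route `RenyiTelescope` — glue item `HistoryTailOfRenyiTelescope` (stmt-QuantumFields-27139): the CONDITIONAL TELESCOPE lemma (G3 of the glue plan)

The glue `CutoffRenyiL → FineRegimeUnitTailL → HistoryTailL` (LINE 6 of ideator seat ym-r3-idea-2 g3; glue plan `glue27139_plan.md` attached to the item)
iterates the crux `CutoffRenyiL` across cut-offs `J = J₀, J₀+1, …` at a fixed (refined) family.  THIS FILE isolates and proves the purely
real-variable part of that iteration, so that the glue prover only has to feed it the crux and the base:

* `prod_one_sub_ge_one_sub_sum` — Weierstrass: `∏_{i<n} (1 − x_i) ≥ 1 − ∑_{i<n} x_i` for `x_i ∈ [0,1]`;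
* `conditional_telescope` — for non-negative reals `u_J ≤ P_J`, `P_J > 0` and steps
  `u_{J+1}·P_J^{1−1/q_J} ≤ e^{D_J}·u_J^{1−1/q_J}·P_{J+1}` (`q_J > 1`, `D_J ≥ 0`; the event form of `CutoffRenyiL` with `u_J = μ_J(E ∩ Int_J)`,
  `P_J = μ_J(Int_J)`), the CONDITIONAL ratios `ū_J := u_J/P_J` satisfy `ū_{J₀+n} ≤ exp(∑_{i<n} D_{J₀+i}) · ū_{J₀}^{∏_{i<n}(1 − 1/q_{J₀+i})}` —
  intermediate conditioning masses CANCEL (only their positivity is used);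
* `conditional_telescope_sqrt` — with the order budget `∑_{i<n} 1/q_{J₀+i} ≤ 1/2` and `P ≤ 1`:  `u_{J₀+n} ≤ exp(∑ D) · (u_{J₀}/P_{J₀})^{1/2}`.

HONEST SCOPE.  Elementary real analysis; the cruxes, the glue, the route and rung R3 stay open; nothing here bears on the Yang–Mills mass gap. [folklore]
-/

noncomputable section

open Finset

namespace Summit.QuantumFields.YangMills.Theorems.RenyiTelescope

/-- Weierstrass' product inequality: `1 − ∑_{i<n} x i ≤ ∏_{i<n} (1 − x i)` for `0 ≤ x i ≤ 1`. [folklore] -/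
theorem prod_one_sub_ge_one_sub_sum (x : ℕ → ℝ) (hx : ∀ i, 0 ≤ x i ∧ x i ≤ 1) :
    ∀ n : ℕ, 1 - ∑ i ∈ range n, x i ≤ ∏ i ∈ range n, (1 - x i) := by
  intro n
  induction n with
  | zero => simp
  | succ n ih =>
    rw [sum_range_succ, prod_range_succ]
    have h1 : 0 ≤ 1 - x n := sub_nonneg.mpr (hx n).2
    have h2 : (1 - ∑ i ∈ range n, x i) * (1 - x n) ≤ (∏ i ∈ range n, (1 - x i)) * (1 - x n) :=
      mul_le_mul_of_nonneg_right ih h1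
    have h3 : 0 ≤ (∑ i ∈ range n, x i) * x n :=
      mul_nonneg (sum_nonneg fun i _ => (hx i).1) (hx n).1
    nlinarith

/-- The product of the Hölder exponents lies in `[0, 1]`. -/
theorem prod_one_sub_inv_mem (q : ℕ → ℝ) (hq : ∀ i, 1 < q i) (n : ℕ) :
    0 ≤ ∏ i ∈ range n, (1 - 1 / q i) ∧ ∏ i ∈ range n, (1 - 1 / q i) ≤ 1 := by
  refine ⟨prod_nonneg fun i _ => ?_, prod_le_one (fun i _ => ?_) fun i _ => ?_⟩
  · have := hq i; rw [sub_nonneg, div_le_one (by linarith)]; linarith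
  · have := hq i; rw [sub_nonneg, div_le_one (by linarith)]; linarith
  · have := hq i; have : 0 ≤ 1 / q i := by positivity
    linarith

/-- **CONDITIONAL TELESCOPE.**  `u, P, q, D : ℕ → ℝ`, a start `J₀` and a number of steps `n`; if `0 ≤ u_J ≤ P_J`, `0 < P_J` on `[J₀, J₀+n]` and for every
`J ∈ [J₀, J₀+n)`: `1 < q_J`, `0 ≤ D_J` and `u_{J+1}·P_J^{1−1/q_J} ≤ exp(D_J)·u_J^{1−1/q_J}·P_{J+1}`, then
`u_{J₀+n}/P_{J₀+n} ≤ exp(∑_{i<n} D_{J₀+i}) · (u_{J₀}/P_{J₀})^{∏_{i<n} (1 − 1/q_{J₀+i})}`. [folklore] -/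
theorem conditional_telescope (u P q D : ℕ → ℝ) (J₀ : ℕ) :
    ∀ n : ℕ,
      (∀ J, J₀ ≤ J → J ≤ J₀ + n → 0 ≤ u J ∧ 0 < P J ∧ u J ≤ P J) →
      (∀ J, J₀ ≤ J → J < J₀ + n → 1 < q J ∧ 0 ≤ D J ∧
        u (J + 1) * P J ^ (1 - 1 / q J) ≤ Real.exp (D J) * u J ^ (1 - 1 / q J) * P (J + 1)) →
      u (J₀ + n) / P (J₀ + n) ≤
        Real.exp (∑ i ∈ range n, D (J₀ + i)) * (u J₀ / P J₀) ^ (∏ i ∈ range n, (1 - 1 / q (J₀ + i))) := by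
  intro n
  induction n with
  | zero =>
    intro _ _
    simp
  | succ n ih =>
    intro hmass hstep
    -- the data up to step `n`
    have hmass' : ∀ J, J₀ ≤ J → J ≤ J₀ + n → 0 ≤ u J ∧ 0 < P J ∧ u J ≤ P J :=
      fun J h1 h2 => hmass J h1 (by omega)
    have hstep' : ∀ J, J₀ ≤ J → J < J₀ + n → 1 < q J ∧ 0 ≤ D J ∧
        u (J + 1) * P J ^ (1 - 1 / q J) ≤ Real.exp (D J) * u J ^ (1 - 1 / q J) * P (J + 1) :=
      fun J h1 h2 => hstep J h1 (by omega)
    have IH := ih hmass' hstep'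
    -- abbreviations
    set Jn : ℕ := J₀ + n with hJn
    have hJsucc : J₀ + (n + 1) = Jn + 1 := by rw [hJn]; ring
    obtain ⟨hu0, hP0, -⟩ := hmass Jn (by omega) (by omega)
    obtain ⟨-, hP1, -⟩ := hmass (Jn + 1) (by omega) (by omega)
    obtain ⟨hq1, -, hst⟩ := hstep Jn (by omega) (by omega)
    obtain ⟨hub0, hPb0, -⟩ := hmass J₀ le_rfl (by omega)
    set a : ℝ := 1 - 1 / q Jn with ha
    have ha0 : 0 ≤ a := by
      rw [ha, sub_nonneg, div_le_one (by linarith)]; linarith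
    have ha1 : a ≤ 1 := by
      have : 0 ≤ 1 / q Jn := by positivity
      rw [ha]; linarith
    set S : ℝ := ∑ i ∈ range n, D (J₀ + i)
    have hS0 : 0 ≤ S := sum_nonneg fun i hi => (hstep' (J₀ + i) (by omega) (by simp at hi; omega)).2.1
    set Pr0 : ℝ := ∏ i ∈ range n, (1 - 1 / q (J₀ + i))
    set x : ℝ := u J₀ / P J₀
    have hx0 : 0 ≤ x := div_nonneg hub0 hPb0.le
    -- the ratio at `Jn`
    set y : ℝ := u Jn / P Jn with hy
    have hy0 : 0 ≤ y := div_nonneg hu0 hP0.le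
    -- one step: `u (Jn+1) / P (Jn+1) ≤ exp (D Jn) * y ^ a`
    have hstep1 : u (Jn + 1) / P (Jn + 1) ≤ Real.exp (D Jn) * y ^ a := by
      rw [div_le_iff₀ hP1]
      have hya : y ^ a = u Jn ^ a / P Jn ^ a := by rw [hy, Real.div_rpow hu0 hP0.le]
      have hPa : 0 < P Jn ^ a := Real.rpow_pos_of_pos hP0 a
      rw [hya]
      have : Real.exp (D Jn) * (u Jn ^ a / P Jn ^ a) * P (Jn + 1)
          = Real.exp (D Jn) * u Jn ^ a * P (Jn + 1) / P Jn ^ a := by ring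
      rw [this, le_div_iff₀ hPa]
      exact hst
    -- plug the induction hypothesis: `y ≤ exp S * x ^ Pr0`
    have hIH : y ≤ Real.exp S * x ^ Pr0 := IH
    have hya_le : y ^ a ≤ (Real.exp S * x ^ Pr0) ^ a := Real.rpow_le_rpow hy0 hIH ha0
    have hsplit : (Real.exp S * x ^ Pr0) ^ a = Real.exp (S * a) * x ^ (Pr0 * a) := by
      rw [Real.mul_rpow (Real.exp_pos S).le (Real.rpow_nonneg hx0 _), ← Real.exp_mul, ← Real.rpow_mul hx0]
    have hexp : Real.exp (S * a) ≤ Real.exp S := by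
      rw [Real.exp_le_exp]; nlinarith
    -- assemble
    rw [hJsucc, sum_range_succ, prod_range_succ, Real.exp_add]
    calc u (Jn + 1) / P (Jn + 1)
        ≤ Real.exp (D Jn) * y ^ a := hstep1
      _ ≤ Real.exp (D Jn) * (Real.exp (S * a) * x ^ (Pr0 * a)) := by
          rw [← hsplit]; exact mul_le_mul_of_nonneg_left hya_le (Real.exp_pos _).le
      _ ≤ Real.exp (D Jn) * (Real.exp S * x ^ (Pr0 * a)) := by
          refine mul_le_mul_of_nonneg_left ?_ (Real.exp_pos _).le
          exact mul_le_mul_of_nonneg_right hexp (Real.rpow_nonneg hx0 _)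
      _ = Real.exp S * Real.exp (D Jn) * x ^ (Pr0 * a) := by ring
      _ = Real.exp S * Real.exp (D (J₀ + n)) * x ^ (Pr0 * (1 - 1 / q (J₀ + n))) := by rw [ha, hJn]

/-- **THE USABLE FORM.**  Under the same hypotheses plus `P_J ≤ 1` at the end and the Hölder ORDER BUDGET `∑_{i<n} 1/q_{J₀+i} ≤ 1/2`:
`u_{J₀+n} ≤ exp(∑_{i<n} D_{J₀+i}) · (u_{J₀}/P_{J₀})^{1/2}`. [folklore] -/
theorem conditional_telescope_sqrt (u P q D : ℕ → ℝ) (J₀ n : ℕ)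
    (hmass : ∀ J, J₀ ≤ J → J ≤ J₀ + n → 0 ≤ u J ∧ 0 < P J ∧ u J ≤ P J)
    (hstep : ∀ J, J₀ ≤ J → J < J₀ + n → 1 < q J ∧ 0 ≤ D J ∧
      u (J + 1) * P J ^ (1 - 1 / q J) ≤ Real.exp (D J) * u J ^ (1 - 1 / q J) * P (J + 1))
    (hPle : P (J₀ + n) ≤ 1) (hbudget : ∑ i ∈ range n, 1 / q (J₀ + i) ≤ 1 / 2) :
    u (J₀ + n) ≤ Real.exp (∑ i ∈ range n, D (J₀ + i)) * (u J₀ / P J₀) ^ (1 / 2 : ℝ) := by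
  have hT := conditional_telescope u P q D J₀ n hmass hstep
  obtain ⟨hu0, hP0, -⟩ := hmass (J₀ + n) (by omega) le_rfl
  obtain ⟨hub0, hPb0, hubP⟩ := hmass J₀ le_rfl (by omega)
  set x : ℝ := u J₀ / P J₀
  have hx0 : 0 ≤ x := div_nonneg hub0 hPb0.le
  have hx1 : x ≤ 1 := (div_le_one hPb0).mpr hubP
  -- restrict attention to `range n`, where `1 < q`
  have hPr : 1 / 2 ≤ ∏ i ∈ range n, (1 - 1 / q (J₀ + i)) := by
    -- Weierstrass on the truncated sequence `x' i := if i < n then 1/q(J₀+i) else 0`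
    set x' : ℕ → ℝ := fun i => if i < n then 1 / q (J₀ + i) else 0 with hx'
    have hx'b : ∀ i, 0 ≤ x' i ∧ x' i ≤ 1 := by
      intro i
      by_cases hi : i < n
      · have hqi := (hstep (J₀ + i) (by omega) (by omega)).1
        simp only [hx', if_pos hi]
        exact ⟨by positivity, by rw [div_le_one (by linarith)]; linarith⟩
      · simp [hx', if_neg hi]
    have hW := prod_one_sub_ge_one_sub_sum x' hx'b n
    have hs : ∑ i ∈ range n, x' i = ∑ i ∈ range n, 1 / q (J₀ + i) :=
      sum_congr rfl fun i hi => by simp [hx', mem_range.mp hi]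
    have hp : ∏ i ∈ range n, (1 - x' i) = ∏ i ∈ range n, (1 - 1 / q (J₀ + i)) :=
      prod_congr rfl fun i hi => by simp [hx', mem_range.mp hi]
    rw [hs, hp] at hW
    linarith
  -- monotonicity of `x ^ ·` on `[0,1]` (antitone in the exponent)
  have hpow : x ^ (∏ i ∈ range n, (1 - 1 / q (J₀ + i))) ≤ x ^ (1 / 2 : ℝ) :=
    Real.rpow_le_rpow_of_exponent_ge_of_imp hx0 hx1 hPr (fun _ h => by rw [h] at hPr; norm_num at hPr)
  -- `u ≤ (u/P)·1`
  have hu_le : u (J₀ + n) ≤ u (J₀ + n) / P (J₀ + n) := by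
    rw [le_div_iff₀ hP0]
    calc u (J₀ + n) * P (J₀ + n) ≤ u (J₀ + n) * 1 := mul_le_mul_of_nonneg_left hPle hu0
      _ = u (J₀ + n) := mul_one _
  calc u (J₀ + n) ≤ u (J₀ + n) / P (J₀ + n) := hu_le
    _ ≤ Real.exp (∑ i ∈ range n, D (J₀ + i)) * x ^ (∏ i ∈ range n, (1 - 1 / q (J₀ + i))) := hT
    _ ≤ Real.exp (∑ i ∈ range n, D (J₀ + i)) * x ^ (1 / 2 : ℝ) :=
        mul_le_mul_of_nonneg_left hpow (Real.exp_pos _).le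

/-- **STUB `stub_conditionalTelescope` of the glue item `HistoryTailOfRenyiTelescope` (stmt-QuantumFields-27139), exactly as registered.** [folklore] -/
theorem stub_conditionalTelescope : ∀ (u P q D : ℕ → ℝ) (J₀ n : ℕ),
      (∀ J, J₀ ≤ J → J ≤ J₀ + n → 0 ≤ u J ∧ 0 < P J ∧ u J ≤ P J) →
      (∀ J, J₀ ≤ J → J < J₀ + n → 1 < q J ∧ 0 ≤ D J ∧
        u (J + 1) * P J ^ (1 - 1 / q J) ≤ Real.exp (D J) * u J ^ (1 - 1 / q J) * P (J + 1)) →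
      P (J₀ + n) ≤ 1 → ∑ i ∈ Finset.range n, 1 / q (J₀ + i) ≤ 1 / 2 →
      u (J₀ + n) ≤ Real.exp (∑ i ∈ Finset.range n, D (J₀ + i)) * (u J₀ / P J₀) ^ (1 / 2 : ℝ) :=
  fun u P q D J₀ n hmass hstep hPle hbudget => conditional_telescope_sqrt u P q D J₀ n hmass hstep hPle hbudget

end Summit.QuantumFields.YangMills.Theorems.RenyiTelescope

end
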